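import Literature.Analysis.ODE.GlobalExistence
import Literature.Analysis.ODE.FlowDomain
import Mathlib.Analysis.Calculus.MeanValue
import Mathlib.Analysis.Calculus.ContDiff.RCLike
import Mathlib.Analysis.Normed.Module.FiniteDimension
import HarnessLib

/-!
# Regular level curves I: global trajectories of the tangent field

Topic `Literature/Analysis/ODE`. The differential-topological core of Khovanskii's method of
counting zeros on curves (A. G. Khovanskii, *Fewnomials*, Transl. Math. Monogr. 88 (AMS 1991),
Ch. III, "Analogues of the theorems of Rolle and Bezout for separating solutions of Pfaff equations"; J.-J. Risler, *Complexité et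
géométrie réelle (d'après A. Khovansky)*, Sém. Bourbaki 637 (1984–85), §2), set up for a
**regular level curve** `Γ = H⁻¹(0) ⊆ ℝ^{d+1}` of a `C¹` map `H : ℝ^{d+1} → ℝ^d` together with a
`C¹` vector field `v` which is tangent to the level sets of `H` (`dH(v) = 0` everywhere) and, along
`Γ`, non-vanishing with `dH` onto (`LevelCurveData`; the model is the generalized cross product
of the gradients `∇H₁, …, ∇H_d`, see `Literature/LinearAlgebra/Matrix/CrossProduct.lean`).
Everything here is **proved**; no named facts:

* `exists_solution_real_of_norm_le` — through every point of a finite-dimensional space passes a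
  global (two-sided) integral curve of a bounded `C¹` vector field (continuation principle of
  `GlobalExistence.lean` with the a priori bound `‖α t‖ ≤ ‖x₀‖ + B t`);
* `LevelCurveData.field` — the bounded renormalisation `w = v / (1 + Σ vⱼ²)` (`‖w‖ ≤ 1`) and its
  global trajectories `LevelCurveData.traj z : ℝ → ℝ^{d+1}` (`traj_zero`, `hasDerivAt_traj`),
  uniqueness (`eq_traj_of_hasDerivAt`) and the flow property `traj z (s + t) = traj (traj z s) t`;
* `LevelCurveData.H_traj` — `H` is constant along trajectories, so trajectories issued from `Γ`
  stay in `Γ`;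
* `LevelCurveData.injOn_traj_nhds` — trajectories in `Γ` are locally injective (`w ≠ 0` on `Γ`);
* `LevelCurveData.injective_or_periodic` — a trajectory in `Γ` is either injective or periodic
  with a least period `T > 0`, and then injective on every `[a, a + T)` (Khovanskii 1991, Ch. III: the phase curves of a non-vanishing field are lines or circles).

The flow box (a neighbourhood of a point of `Γ` meets `Γ` in an arc of one trajectory), the
properness of injective trajectories and the Rolle–Khovanskii count are in the sequel files
`RegularLevelCurvesFlowBox.lean`, `RolleKhovanskii.lean`.

## References

* A. G. Khovanskii, *Fewnomials*, Transl. Math. Monogr. 88, AMS (1991), Ch. III.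
* J.-J. Risler, *Complexité et géométrie réelle (d'après A. Khovansky)*, Séminaire Bourbaki,
  exp. 637, Astérisque 133–134 (1986), 89–100, §2.
* P. Hartman, *Ordinary Differential Equations*, Classics in Applied Mathematics 38 (SIAM 2002),
  Ch. II, Thm. 3.1, Cor. 3.1 (held: `book:hartman2002-ordinary-differential-equations`, PDF
  pp. 22–24). [Hartman2002]
-/

noncomputable section

open Set Metric Filter Function
open scoped Topology NNReal

namespace Literature.Analysis.ODE

/-! ### Global integral curves of bounded `C¹` vector fields -/

section Bounded

variable {E : Type*} [NormedAddCommGroup E] [NormedSpace ℝ E] [FiniteDimensional ℝ E]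

/-- A `C¹` vector field on a finite-dimensional space is Lipschitz on every closed ball.
[folklore] -/
theorem exists_lipschitzOnWith_closedBall_of_contDiff {f : E → E} (hf : ContDiff ℝ 1 f)
    (x : E) (r : ℝ) : ∃ K : ℝ≥0, LipschitzOnWith K f (closedBall x r) := by
  have hcont : Continuous (fderiv ℝ f) := hf.continuous_fderiv one_ne_zero
  obtain ⟨C, hC⟩ := (isCompact_closedBall x r).exists_bound_of_continuousOn hcont.continuousOn
  refine ⟨Real.toNNReal C, ?_⟩
  refine (convex_closedBall x r).lipschitzOnWith_of_nnnorm_fderiv_le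
    (fun y _ => (hf.differentiable one_ne_zero) y) fun y hy => ?_
  have h := hC y hy
  rw [← NNReal.coe_le_coe, coe_nnnorm, Real.coe_toNNReal']
  exact h.trans (le_max_left _ _)

/-- **Forward global existence for a bounded `C¹` field**: if `‖f‖ ≤ B` everywhere then through
every point there is an integral curve on `[0, ∞)` (a solution on `[0, s]` satisfies the a priori
bound `‖α t‖ ≤ ‖x₀‖ + B s` by the mean value inequality, and the continuation principle
`exists_solution_Ici_of_apriori_bound` applies; Hartman, Ch. II, Thm. 3.1 (extension over a
maximal interval) with Cor. 3.1 (on a strip, a bounded solution exists on the whole interval)). [cite: Hartman2002, Ch. II, Thm. 3.1 and Cor. 3.1 (PDF pp. 22–24)] -/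
theorem exists_solution_Ici_of_norm_le {f : E → E} (hf : ContDiff ℝ 1 f) {B : ℝ}
    (hB : ∀ x, ‖f x‖ ≤ B) (x₀ : E) :
    ∃ α : ℝ → E, α 0 = x₀ ∧ (∀ t, 0 ≤ t → HasDerivWithinAt α (f (α t)) (Ici 0) t) ∧
      ∀ t, 0 < t → HasDerivAt α (f (α t)) t := by
  have hB0 : 0 ≤ B := (norm_nonneg _).trans (hB x₀)
  have hlip : ∀ T ρ : ℝ, ∃ K : ℝ≥0, ∀ t ∈ Icc (0 : ℝ) T,
      LipschitzOnWith K ((fun (_ : ℝ) (x : E) => f x) t) (closedBall 0 ρ) := by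
    intro T ρ
    obtain ⟨K, hK⟩ := exists_lipschitzOnWith_closedBall_of_contDiff hf (0 : E) ρ
    exact ⟨K, fun _ _ => hK⟩
  have hapriori : ∀ T : ℝ, 0 ≤ T → ∃ R : ℝ, ‖x₀‖ ≤ R ∧ ∀ s ∈ Icc 0 T, ∀ α : ℝ → E, α 0 = x₀ →
      (∀ t ∈ Icc 0 s, HasDerivWithinAt α ((fun (_ : ℝ) (x : E) => f x) t (α t)) (Icc 0 s) t) →
        ∀ t ∈ Icc 0 s, ‖α t‖ ≤ R := by
    intro T hT
    refine ⟨‖x₀‖ + B * T, by nlinarith, fun s hs α hα0 hα t ht => ?_⟩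
    have h := norm_image_sub_le_of_norm_deriv_le_segment' hα (fun τ _ => hB (α τ)) t ht
    rw [hα0, sub_zero] at h
    calc ‖α t‖ = ‖(α t - x₀) + x₀‖ := by rw [sub_add_cancel]
      _ ≤ ‖α t - x₀‖ + ‖x₀‖ := norm_add_le _ _
      _ ≤ B * t + ‖x₀‖ := by linarith
      _ ≤ ‖x₀‖ + B * T := by nlinarith [ht.2.trans hs.2]
  obtain ⟨α, h0, -, hIci, hpos⟩ := exists_solution_Ici_of_apriori_bound
    (v := fun (_ : ℝ) (x : E) => f x) (x₀ := x₀) hlip (fun _ => continuousOn_const) hapriori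
  exact ⟨α, h0, hIci, hpos⟩

/-- **Global existence on `ℝ` for a bounded `C¹` field** on a finite-dimensional space: through
every point passes an integral curve defined for all times (forward solutions of `f` and `-f`
glued at `t = 0`). [cite: Hartman2002, Ch. II, Thm. 3.1 and Cor. 3.1 (PDF pp. 22–24)] -/
theorem exists_solution_real_of_norm_le {f : E → E} (hf : ContDiff ℝ 1 f) {B : ℝ}
    (hB : ∀ x, ‖f x‖ ≤ B) (x₀ : E) : ∃ α : ℝ → E, α 0 = x₀ ∧ ∀ t, HasDerivAt α (f (α t)) t := by
  obtain ⟨αp, h0p, hIcip, hposp⟩ := exists_solution_Ici_of_norm_le hf hB x₀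
  have hfn : ContDiff ℝ 1 fun x => -f x := hf.neg
  have hBn : ∀ x, ‖-f x‖ ≤ B := fun x => by rw [norm_neg]; exact hB x
  obtain ⟨αm, h0m, hIcim, hposm⟩ := exists_solution_Ici_of_norm_le hfn hBn x₀
  refine ⟨fun t => if 0 ≤ t then αp t else (αm ∘ Neg.neg) t, by simp [h0p], fun t => ?_⟩
  show HasDerivAt _ (f (if 0 ≤ t then αp t else (αm ∘ Neg.neg) t)) t
  rcases lt_trichotomy t 0 with ht | rfl | ht
  · have hev : (fun s => if 0 ≤ s then αp s else (αm ∘ Neg.neg) s) =ᶠ[𝓝 t] (αm ∘ Neg.neg) := by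
      filter_upwards [Iio_mem_nhds ht] with s hs
      rw [if_neg (not_le.2 hs)]
    have hd : HasDerivAt (αm ∘ Neg.neg) (f ((αm ∘ Neg.neg) t)) t := by
      have h1 := hposm (-t) (by linarith)
      have h2 := h1.scomp t (hasDerivAt_neg (x := t))
      rwa [neg_smul, one_smul, neg_neg] at h2
    rw [if_neg (not_le.2 ht)]
    exact hd.congr_of_eventuallyEq hev
  · rw [if_pos le_rfl, h0p]
    have hr : HasDerivWithinAt (fun s => if 0 ≤ s then αp s else (αm ∘ Neg.neg) s) (f x₀)
        (Ici 0) 0 := by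
      have h1 := hIcip 0 le_rfl
      rw [h0p] at h1
      exact h1.congr (fun s hs => by rw [if_pos (mem_Ici.1 hs)]) (by simp [h0p])
    have hl : HasDerivWithinAt (fun s => if 0 ≤ s then αp s else (αm ∘ Neg.neg) s) (f x₀)
        (Iic 0) 0 := by
      have h1 := hIcim 0 le_rfl
      rw [h0m] at h1
      have h2 : HasDerivWithinAt (αm ∘ Neg.neg) ((-1 : ℝ) • -f x₀) (Iic 0) 0 :=
        h1.scomp_of_eq (0 : ℝ) (hasDerivWithinAt_neg (x := (0 : ℝ)) (s := Iic 0))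
          (fun s hs => mem_Ici.2 (neg_nonneg.2 (mem_Iic.1 hs))) neg_zero.symm
      rw [neg_smul, one_smul, neg_neg] at h2
      refine h2.congr (fun s hs => ?_) (by simp [h0p, h0m])
      rcases (mem_Iic.1 hs).lt_or_eq with hs' | rfl
      · rw [if_neg (not_le.2 hs')]
      · simp [h0p, h0m]
    have := hl.union hr
    rwa [Iic_union_Ici, hasDerivWithinAt_univ] at this
  · have hev : (fun s => if 0 ≤ s then αp s else (αm ∘ Neg.neg) s) =ᶠ[𝓝 t] αp := by
      filter_upwards [Ioi_mem_nhds ht] with s hs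
      rw [if_pos (le_of_lt hs)]
    rw [if_pos ht.le]
    exact (hposp t ht).congr_of_eventuallyEq hev

omit [FiniteDimensional ℝ E] in
/-- **Uniqueness** of global integral curves of a `C¹` field: two integral curves on `ℝ` agreeing
at one time agree everywhere. [folklore] -/
theorem eq_of_hasDerivAt_real {f : E → E} (hf : ContDiff ℝ 1 f) {γ₁ γ₂ : ℝ → E} {t₀ : ℝ}
    (h₁ : ∀ t, HasDerivAt γ₁ (f (γ₁ t)) t) (h₂ : ∀ t, HasDerivAt γ₂ (f (γ₂ t)) t)
    (heq : γ₁ t₀ = γ₂ t₀) : γ₁ = γ₂ := by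
  have hlip : LocallyLipschitzOn univ f :=
    locallyLipschitzOn_of_contDiffOn isOpen_univ hf.contDiffOn le_rfl
  funext t
  set R : ℝ := |t - t₀| + 1 with hR
  have ht : t ∈ Ioo (t₀ - R) (t₀ + R) := by
    constructor <;> cases abs_cases (t - t₀) <;> linarith
  exact eqOn_Ioo_of_hasDerivAt isOpen_univ hlip (a := t₀ - R) (b := t₀ + R) (t₀ := t₀)
    ⟨by linarith [abs_nonneg (t - t₀)], by linarith [abs_nonneg (t - t₀)]⟩
    (fun s _ => h₁ s) (fun _ _ => mem_univ _) (fun s _ => h₂ s) heq ht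

end Bounded

/-! ### Regular level curves with a tangent field -/

/-- **A regular level curve with a tangent field.** `H : ℝ^{d+1} → ℝ^d` and `v : ℝ^{d+1} → ℝ^{d+1}`
of class `C¹` with `dH_z(v(z)) = 0` for all `z`, and, at every point of `Γ = H⁻¹(0)`, `v ≠ 0`
and `dH_z` onto (so `Γ` is a closed one-dimensional `C¹` submanifold and `v` spans its tangent
lines). The model: `v = ∇H₁ × ⋯ × ∇H_d`, the generalized cross product (Khovanskii 1991, Ch. III; Milnor 1965, §2). [folklore] -/
structure LevelCurveData (d : ℕ) where
  /-- the defining map `H : ℝ^{d+1} → ℝ^d` -/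
  H : (Fin (d + 1) → ℝ) → (Fin d → ℝ)
  /-- the tangent field -/
  v : (Fin (d + 1) → ℝ) → (Fin (d + 1) → ℝ)
  contDiff_H : ContDiff ℝ 1 H
  contDiff_v : ContDiff ℝ 1 v
  fderiv_H_v : ∀ z, fderiv ℝ H z (v z) = 0
  v_ne_zero : ∀ ⦃z⦄, H z = 0 → v z ≠ 0
  surjective_fderiv : ∀ ⦃z⦄, H z = 0 → Function.Surjective (fderiv ℝ H z)

namespace LevelCurveData

variable {d : ℕ} (D : LevelCurveData d)

/-- The curve `Γ = H⁻¹(0)`. [folklore] -/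
def curve : Set (Fin (d + 1) → ℝ) := {z | D.H z = 0}

/-- Membership in `Γ`. [folklore] -/
theorem mem_curve {z : Fin (d + 1) → ℝ} : z ∈ D.curve ↔ D.H z = 0 := Iff.rfl

/-- `Γ` is closed. [folklore] -/
theorem isClosed_curve : IsClosed D.curve :=
  isClosed_eq D.contDiff_H.continuous continuous_const

/-- The normalising factor `(1 + Σⱼ vⱼ(z)²)⁻¹`. [folklore] -/
def nf (z : Fin (d + 1) → ℝ) : ℝ := (1 + ∑ j, (D.v z j) ^ 2)⁻¹

/-- The renormalised, bounded tangent field `w = v / (1 + Σⱼ vⱼ²)`. [folklore] -/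
def field (z : Fin (d + 1) → ℝ) : Fin (d + 1) → ℝ := D.nf z • D.v z

/-- `1 + Σ vⱼ² > 0`. [folklore] -/
theorem one_add_sum_sq_pos (z : Fin (d + 1) → ℝ) : 0 < 1 + ∑ j, (D.v z j) ^ 2 := by
  have := Finset.sum_nonneg fun j (_ : j ∈ (Finset.univ : Finset (Fin (d + 1)))) =>
    sq_nonneg (D.v z j)
  linarith

/-- The normalising factor is positive. [folklore] -/
theorem nf_pos (z : Fin (d + 1) → ℝ) : 0 < D.nf z := inv_pos.2 (D.one_add_sum_sq_pos z)

/-- The normalising factor is `C¹`. [folklore] -/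
theorem contDiff_nf : ContDiff ℝ 1 D.nf := by
  have h1 : ContDiff ℝ 1 fun z => 1 + ∑ j, (D.v z j) ^ 2 := by
    refine contDiff_const.add (ContDiff.sum fun j _ => ?_)
    exact ((contDiff_apply ℝ ℝ j).comp D.contDiff_v).pow 2
  exact h1.inv fun z => (D.one_add_sum_sq_pos z).ne'

/-- The renormalised field is `C¹`. [folklore] -/
theorem contDiff_field : ContDiff ℝ 1 D.field := D.contDiff_nf.smul D.contDiff_v

/-- The renormalised field is bounded by `1` (sup norm): `|vⱼ| ≤ 1 + vⱼ² ≤ 1 + Σ vᵢ²`. [folklore] -/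
theorem norm_field_le (z : Fin (d + 1) → ℝ) : ‖D.field z‖ ≤ 1 := by
  rw [pi_norm_le_iff_of_nonneg zero_le_one]
  intro j
  rw [field, Pi.smul_apply, smul_eq_mul, Real.norm_eq_abs, abs_mul, nf,
    abs_of_pos (inv_pos.2 (D.one_add_sum_sq_pos z)), inv_mul_le_iff₀ (D.one_add_sum_sq_pos z),
    mul_one]
  have hj : (D.v z j) ^ 2 ≤ ∑ i, (D.v z i) ^ 2 :=
    Finset.single_le_sum (fun i _ => sq_nonneg (D.v z i)) (Finset.mem_univ j)
  nlinarith [abs_nonneg (D.v z j), sq_abs (D.v z j)]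

/-- `dH(w) = 0` everywhere. [folklore] -/
theorem fderiv_H_field (z : Fin (d + 1) → ℝ) : fderiv ℝ D.H z (D.field z) = 0 := by
  rw [field, map_smul, D.fderiv_H_v, smul_zero]

/-- `w ≠ 0` on `Γ`. [folklore] -/
theorem field_ne_zero {z : Fin (d + 1) → ℝ} (hz : z ∈ D.curve) : D.field z ≠ 0 := by
  rw [field, smul_ne_zero_iff]
  exact ⟨(D.nf_pos z).ne', D.v_ne_zero hz⟩

/-! ### Global trajectories -/

/-- The **trajectory** of the renormalised tangent field through `z` at time `0` (a global
integral curve, by choice; characterised by `traj_zero`, `hasDerivAt_traj` and uniqueness).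
[folklore] -/
def traj (z : Fin (d + 1) → ℝ) : ℝ → Fin (d + 1) → ℝ :=
  Classical.choose (exists_solution_real_of_norm_le D.contDiff_field D.norm_field_le z)

/-- The trajectory starts at `z`. [folklore] -/
@[simp] theorem traj_zero (z : Fin (d + 1) → ℝ) : D.traj z 0 = z :=
  (Classical.choose_spec (exists_solution_real_of_norm_le D.contDiff_field D.norm_field_le z)).1

/-- The trajectory is an integral curve of `w`. [folklore] -/
theorem hasDerivAt_traj (z : Fin (d + 1) → ℝ) (t : ℝ) :
    HasDerivAt (D.traj z) (D.field (D.traj z t)) t :=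
  (Classical.choose_spec (exists_solution_real_of_norm_le D.contDiff_field D.norm_field_le z)).2 t

/-- Trajectories are continuous. [folklore] -/
theorem continuous_traj (z : Fin (d + 1) → ℝ) : Continuous (D.traj z) :=
  continuous_iff_continuousAt.2 fun t => (D.hasDerivAt_traj z t).continuousAt

/-- Trajectories are `C¹`. [folklore] -/
theorem contDiff_traj (z : Fin (d + 1) → ℝ) : ContDiff ℝ 1 (D.traj z) := by
  rw [contDiff_one_iff_deriv]
  refine ⟨fun t => (D.hasDerivAt_traj z t).differentiableAt, ?_⟩
  have : deriv (D.traj z) = fun t => D.field (D.traj z t) := funext fun t =>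
    (D.hasDerivAt_traj z t).deriv
  rw [this]
  exact D.contDiff_field.continuous.comp (D.continuous_traj z)

/-- **Uniqueness**: an integral curve of `w` on `ℝ` is the trajectory through its value at `0`,
shifted. [folklore] -/
theorem eq_traj_of_hasDerivAt {γ : ℝ → Fin (d + 1) → ℝ} (hγ : ∀ t, HasDerivAt γ (D.field (γ t)) t)
    (t₀ : ℝ) : γ = fun t => D.traj (γ t₀) (t - t₀) := by
  refine eq_of_hasDerivAt_real D.contDiff_field (t₀ := t₀) hγ (fun t => ?_) (by simp)
  have h : HasDerivAt (fun t => D.traj (γ t₀) (t - t₀))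
      ((1 : ℝ) • D.field (D.traj (γ t₀) (t - t₀))) t :=
    (D.hasDerivAt_traj (γ t₀) (t - t₀)).scomp t ((hasDerivAt_id t).sub_const t₀)
  rwa [one_smul] at h

/-- **Flow property** `traj z (s + t) = traj (traj z s) t`. [folklore] -/
theorem traj_add (z : Fin (d + 1) → ℝ) (s t : ℝ) : D.traj z (s + t) = D.traj (D.traj z s) t := by
  have h := D.eq_traj_of_hasDerivAt (D.hasDerivAt_traj z) s
  have := congrFun h (s + t)
  simpa using this

/-- A point on a trajectory generates the same trajectory (as a set). [folklore] -/
theorem range_traj_eq_of_mem {z z' : Fin (d + 1) → ℝ} (h : z' ∈ range (D.traj z)) :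
    range (D.traj z') = range (D.traj z) := by
  obtain ⟨s, rfl⟩ := h
  ext x
  constructor
  · rintro ⟨t, rfl⟩
    exact ⟨s + t, D.traj_add z s t⟩
  · rintro ⟨t, rfl⟩
    refine ⟨t - s, ?_⟩
    rw [← D.traj_add]
    simp

/-- `H` is constant along trajectories (`dH(w) = 0`). [folklore] -/
theorem H_traj (z : Fin (d + 1) → ℝ) (t : ℝ) : D.H (D.traj z t) = D.H z := by
  have hderiv : ∀ s, HasDerivAt (fun s => D.H (D.traj z s)) 0 s := by
    intro s
    have h1 : HasFDerivAt D.H (fderiv ℝ D.H (D.traj z s)) (D.traj z s) :=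
      ((D.contDiff_H.differentiable one_ne_zero) _).hasFDerivAt
    have h2 := h1.comp_hasDerivAt s (D.hasDerivAt_traj z s)
    rwa [D.fderiv_H_field] at h2
  have hconst := is_const_of_deriv_eq_zero (f := fun s => D.H (D.traj z s))
    (fun s => (hderiv s).differentiableAt) (fun s => (hderiv s).deriv) t 0
  simpa using hconst

/-- Trajectories issued from `Γ` stay in `Γ`. [folklore] -/
theorem traj_mem_curve {z : Fin (d + 1) → ℝ} (hz : z ∈ D.curve) (t : ℝ) : D.traj z t ∈ D.curve := by
  rw [mem_curve, H_traj]
  exact hz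

/-! ### Local injectivity and the dichotomy injective / periodic -/

/-- A `C¹` curve with nonzero velocity at `t₀` is injective near `t₀`. [folklore] -/
theorem injOn_nhds_of_deriv_ne_zero {F : Type*} [NormedAddCommGroup F] [NormedSpace ℝ F]
    {γ : ℝ → F} {t₀ : ℝ} (hγ : ContDiff ℝ 1 γ) (hne : deriv γ t₀ ≠ 0) :
    ∃ ε > 0, InjOn γ (Ioo (t₀ - ε) (t₀ + ε)) := by
  have hstrict : HasStrictDerivAt γ (deriv γ t₀) t₀ :=
    hγ.contDiffAt.hasStrictDerivAt one_ne_zero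
  have hpos : 0 < ‖deriv γ t₀‖ / 2 := by positivity
  have h := (Asymptotics.isLittleO_iff.1 hstrict.hasStrictFDerivAt.isLittleO) hpos
  rw [nhds_prod_eq] at h
  obtain ⟨U, hU, hUU⟩ := (eventually_prod_self_iff (r := fun x y : ℝ =>
    ‖γ x - γ y - (ContinuousLinearMap.toSpanSingleton ℝ (deriv γ t₀)) (x - y)‖ ≤
      ‖deriv γ t₀‖ / 2 * ‖x - y‖)).1 h
  obtain ⟨ε, hε, hball⟩ := Metric.mem_nhds_iff.1 hU
  refine ⟨ε, hε, fun s hs s' hs' hss => ?_⟩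
  have hsU : s ∈ U := by
    refine hball ?_
    rw [Metric.mem_ball, Real.dist_eq, abs_lt]
    constructor <;> linarith [hs.1, hs.2]
  have hs'U : s' ∈ U := by
    refine hball ?_
    rw [Metric.mem_ball, Real.dist_eq, abs_lt]
    constructor <;> linarith [hs'.1, hs'.2]
  have key := hUU s hsU s' hs'U
  rw [ContinuousLinearMap.toSpanSingleton_apply, hss, sub_self, zero_sub, norm_neg, norm_smul,
    Real.norm_eq_abs] at key
  by_contra hne'
  have hpos' : 0 < |s - s'| := abs_pos.2 (sub_ne_zero.2 hne')
  nlinarith [norm_nonneg (deriv γ t₀), norm_pos_iff.2 hne]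

/-- Trajectories in `Γ` are locally injective. [folklore] -/
theorem injOn_traj_nhds {z : Fin (d + 1) → ℝ} (hz : z ∈ D.curve) (t₀ : ℝ) :
    ∃ ε > 0, InjOn (D.traj z) (Ioo (t₀ - ε) (t₀ + ε)) := by
  refine injOn_nhds_of_deriv_ne_zero (D.contDiff_traj z) ?_
  rw [(D.hasDerivAt_traj z t₀).deriv]
  exact D.field_ne_zero (D.traj_mem_curve hz t₀)

/-- A coincidence `traj z s₁ = traj z s₂` makes `s₂ - s₁` a period. [folklore] -/
theorem traj_add_eq_of_eq {z : Fin (d + 1) → ℝ} {s₁ s₂ : ℝ} (h : D.traj z s₁ = D.traj z s₂) (t : ℝ) :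
    D.traj z (t + (s₂ - s₁)) = D.traj z t := by
  have e1 : D.traj z (t + (s₂ - s₁)) = D.traj (D.traj z s₂) (t - s₁) := by
    rw [show t + (s₂ - s₁) = s₂ + (t - s₁) by ring, D.traj_add]
  have e2 : D.traj z t = D.traj (D.traj z s₁) (t - s₁) := by
    rw [← D.traj_add]; simp
  rw [e1, e2, h]

/-- **Dichotomy.** A trajectory in `Γ` is either injective, or periodic with a least period
`T > 0` and injective on every half-open interval of length `T` (the phase curves of a non-vanishing field are lines or circles; Khovanskii 1991,
Ch. III). [folklore] -/
theorem injective_or_periodic {z : Fin (d + 1) → ℝ} (hz : z ∈ D.curve) :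
    Injective (D.traj z) ∨ ∃ T > 0, (∀ t, D.traj z (t + T) = D.traj z t) ∧
      ∀ a, InjOn (D.traj z) (Ico a (a + T)) := by
  by_cases hinj : Injective (D.traj z)
  · exact Or.inl hinj
  right
  -- the set of positive periods is nonempty, closed in `(0, ∞)` and bounded away from `0`
  set P : Set ℝ := {τ | 0 < τ ∧ D.traj z τ = z} with hP
  have hne : P.Nonempty := by
    simp only [Injective, not_forall] at hinj
    obtain ⟨s₁, s₂, hs, hne⟩ := hinj
    rcases lt_or_gt_of_ne hne with hlt | hlt
    · refine ⟨s₂ - s₁, sub_pos.2 hlt, ?_⟩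
      have := D.traj_add_eq_of_eq hs 0
      simpa using this
    · refine ⟨s₁ - s₂, sub_pos.2 hlt, ?_⟩
      have := D.traj_add_eq_of_eq hs.symm 0
      simpa using this
  obtain ⟨ε, hε, hinj0⟩ := D.injOn_traj_nhds hz 0
  have hlow : ∀ τ ∈ P, ε ≤ τ := by
    rintro τ ⟨hτ, hτz⟩
    by_contra hlt
    push Not at hlt
    have h0 : (0 : ℝ) ∈ Ioo (0 - ε) (0 + ε) := by constructor <;> linarith
    have hτ' : τ ∈ Ioo (0 - ε) (0 + ε) := by constructor <;> linarith
    have := hinj0 hτ' h0 (by rw [hτz, D.traj_zero])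
    linarith
  set T := sInf P with hT
  have hbdd : BddBelow P := ⟨ε, hlow⟩
  have hTmem : T ∈ P := by
    -- `P ∪ {0}`-closedness: `P = (closed set) ∩ [ε, ∞)`
    have hclosed : IsClosed (P ∩ Ici ε) := by
      have e : P ∩ Ici ε = {τ | D.traj z τ = z} ∩ Ici ε := by
        ext τ
        simp only [hP, mem_inter_iff, mem_setOf_eq, mem_Ici]
        constructor
        · rintro ⟨⟨_, h2⟩, h3⟩; exact ⟨h2, h3⟩
        · rintro ⟨h2, h3⟩; exact ⟨⟨hε.trans_le h3, h2⟩, h3⟩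
      rw [e]
      exact (isClosed_eq (D.continuous_traj z) continuous_const).inter isClosed_Ici
    have hPe : P = P ∩ Ici ε := by
      ext τ; exact ⟨fun h => ⟨h, hlow τ h⟩, fun h => h.1⟩
    have hne' : (P ∩ Ici ε).Nonempty := by rw [← hPe]; exact hne
    have hbdd' : BddBelow (P ∩ Ici ε) := ⟨ε, fun τ h => h.2⟩
    have key := hclosed.csInf_mem hne' hbdd'
    rw [← hPe] at key
    rw [hT]
    exact key
  have hTpos : 0 < T := hTmem.1
  have hper : ∀ t, D.traj z (t + T) = D.traj z t := by
    intro t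
    have := D.traj_add_eq_of_eq (s₁ := 0) (s₂ := T) (by rw [D.traj_zero, hTmem.2]) t
    simpa using this
  refine ⟨T, hTpos, hper, fun a s₁ hs₁ s₂ hs₂ hs => ?_⟩
  by_contra hne12
  rcases lt_or_gt_of_ne hne12 with hlt | hlt
  · have hmem : s₂ - s₁ ∈ P := by
      refine ⟨sub_pos.2 hlt, ?_⟩
      have := D.traj_add_eq_of_eq hs 0
      simpa using this
    have h1 := csInf_le hbdd hmem
    rw [← hT] at h1
    linarith [hs₁.1, hs₁.2, hs₂.1, hs₂.2]
  · have hmem : s₁ - s₂ ∈ P := by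
      refine ⟨sub_pos.2 hlt, ?_⟩
      have := D.traj_add_eq_of_eq hs.symm 0
      simpa using this
    have h1 := csInf_le hbdd hmem
    rw [← hT] at h1
    linarith [hs₁.1, hs₁.2, hs₂.1, hs₂.2]

end LevelCurveData

end Literature.Analysis.ODE
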